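import Summits.HodgeConjecture.HodgeCM.PerL34.FockPrintTorusOrbit_1

/-! PORT of `HodgeCM/PerL34/FockPrintTorusOrbit.lean` (HodgeCMPerL run 82) — part 2: continuation of `Summits.HodgeConjecture.HodgeCM.PerL34.FockPrintTorusOrbit_1` (split at a top-level declaration boundary by port_pkg.py; scope re-opened below; declarations unchanged). -/

-- port_pkg: scope re-opened for this part (file-level context, then the namespace/section stack open at the cut)
noncomputable section
open Filter Topology Complex
open scoped BigOperators TensorProduct
namespace HodgeCM
namespace PerL34
namespace Fock
namespace PrintDict
section Global
variable (RP : Type) [Fintype RP] [DecidableEq RP] (kind : RP → PlaceKind) (lam : RP → ℂ) (hlam : ∀ b, lam b ≠ 0)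
  (m₁ m₂ : RP → ℤ)
variable (α δ : RP → ℝ)
/-- `torusGen` is diagonal on pure tensors of local eigenvectors, with eigenvalue the SUM of the local ones. -/
theorem torusGen_tprod (x : Π b, locM RP kind lam hlam m₁ m₂ b) (c : RP → ℂ)
    (hx : ∀ b, locGen (lam b) (hlam b) (pinnedVacs kind m₁ m₂ b) (m₁ b) (m₂ b) (α b) (δ b) (kind b) (x b) = c b • x b) :
    torusGen RP kind lam hlam m₁ m₂ α δ (PiTensorProduct.tprod ℂ x) = (∑ b, c b) • PiTensorProduct.tprod ℂ x := by
  rw [torusGen, LinearMap.sum_apply, Finset.sum_smul]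
  refine Finset.sum_congr rfl fun b _ => ?_
  rw [slot_tprod, hx b, MultilinearMap.map_update_smul, Function.update_eq_self]

omit [DecidableEq RP] in
/-- The pure tensors of family members SPAN `𝓕^κ_∞` (Mathlib `PiTensorProduct.submodule_span_eq_top` + `locFam_span`). -/
theorem span_tprod_locFam :
    Submodule.span ℂ (Set.range fun i : (Π b, locIdx (kind b)) =>
      PiTensorProduct.tprod ℂ fun b =>
        (locFam (lam b) (hlam b) (pinnedVacs kind m₁ m₂ b) (kind b) (i b) : locM RP kind lam hlam m₁ m₂ b)) = ⊤ :=
  PiTensorProduct.submodule_span_eq_top fun b => locFam_span (lam b) (hlam b) (pinnedVacs kind m₁ m₂ b) (kind b)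

/-- **MAIN THEOREM (KERNEL)**: the `smooth` clause of seam S4 along every torus direction `(α, δ)`, for the pinned printed
places, from the [SETUP D4] equivariance `omg_ins` alone, in ANY topological ℂ-vector space `SK` (see the file header). -/
theorem tendsto_slope_omg_torus {G SK : Type*} [AddCommGroup SK] [Module ℂ SK] [TopologicalSpace SK]
    [IsTopologicalAddGroup SK] [ContinuousSMul ℂ SK]
    (omg : G → SK → SK) (ιT : (pinnedPlaces RP kind lam hlam m₁ m₂).Tg → G)
    (ins : (pinnedPlaces RP kind lam hlam m₁ m₂).F →ₗ[ℂ] SK)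
    (omg_ins : ∀ t φ, omg (ιT t) (ins φ) = ins ((pinnedPlaces RP kind lam hlam m₁ m₂).ωT t φ))
    (e : ℝ → G) (he : ∀ s, e s = ιT (torusCurve RP kind lam hlam m₁ m₂ α δ s))
    (φ : (pinnedPlaces RP kind lam hlam m₁ m₂).F) :
    Tendsto (fun s : ℝ => ((s : ℝ) : ℂ)⁻¹ • (omg (e s) (ins φ) - omg (e 0) (ins φ))) (𝓝[≠] 0)
      (𝓝 (ins (torusGen RP kind lam hlam m₁ m₂ α δ φ))) :=
  (pinnedPlaces RP kind lam hlam m₁ m₂).tendsto_slope_omg omg ιT ins omg_ins e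
    (torusCurve RP kind lam hlam m₁ m₂ α δ) he
    (fun (i : Π b, locIdx (kind b)) b => locFam (lam b) (hlam b) (pinnedVacs kind m₁ m₂ b) (kind b) (i b))
    (span_tprod_locFam RP kind lam hlam m₁ m₂)
    (c := fun i b => locChar (kind b) (m₁ b) (m₂ b) (α b) (δ b) (i b))
    (c' := fun i b => locFreq (kind b) (m₁ b) (m₂ b) (α b) (δ b) (i b))
    (fun i b s => locFam_eigen_pinned (lam b) (hlam b) (kind b) (m₁ b) (m₂ b) (α b) (δ b) (i b) s)
    (fun i b => hasDerivAt_locChar (kind b) (m₁ b) (m₂ b) (α b) (δ b) (i b))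
    (fun i b => locChar_zero (kind b) (m₁ b) (m₂ b) (α b) (δ b) (i b))
    (torusGen RP kind lam hlam m₁ m₂ α δ)
    (fun i => torusGen_tprod RP kind lam hlam m₁ m₂ α δ _ _ fun b =>
      locGen_locFam (lam b) (hlam b) (pinnedVacs kind m₁ m₂ b) (m₁ b) (m₂ b) (α b) (δ b) (kind b) (i b))
    φ

/-- **The `hF`-shaped version (KERNEL)**: after any ℂ-linear observation `Λ` into a normed space (e.g. `pointFunctional`). -/
theorem hasDerivAt_apply_omg_torus {G SK : Type*} [AddCommGroup SK] [Module ℂ SK]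
    {E : Type*} [NormedAddCommGroup E] [NormedSpace ℂ E]
    (omg : G → SK → SK) (ιT : (pinnedPlaces RP kind lam hlam m₁ m₂).Tg → G)
    (ins : (pinnedPlaces RP kind lam hlam m₁ m₂).F →ₗ[ℂ] SK)
    (omg_ins : ∀ t φ, omg (ιT t) (ins φ) = ins ((pinnedPlaces RP kind lam hlam m₁ m₂).ωT t φ))
    (e : ℝ → G) (he : ∀ s, e s = ιT (torusCurve RP kind lam hlam m₁ m₂ α δ s))
    (Λ : SK →ₗ[ℂ] E) (φ : (pinnedPlaces RP kind lam hlam m₁ m₂).F) :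
    HasDerivAt (fun s => Λ (omg (e s) (ins φ))) (Λ (ins (torusGen RP kind lam hlam m₁ m₂ α δ φ))) 0 :=
  (pinnedPlaces RP kind lam hlam m₁ m₂).hasDerivAt_apply_omg omg ιT ins omg_ins e
    (torusCurve RP kind lam hlam m₁ m₂ α δ) he
    (fun (i : Π b, locIdx (kind b)) b => locFam (lam b) (hlam b) (pinnedVacs kind m₁ m₂ b) (kind b) (i b))
    (span_tprod_locFam RP kind lam hlam m₁ m₂)
    (c := fun i b => locChar (kind b) (m₁ b) (m₂ b) (α b) (δ b) (i b))
    (c' := fun i b => locFreq (kind b) (m₁ b) (m₂ b) (α b) (δ b) (i b))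
    (fun i b s => locFam_eigen_pinned (lam b) (hlam b) (kind b) (m₁ b) (m₂ b) (α b) (δ b) (i b) s)
    (fun i b => hasDerivAt_locChar (kind b) (m₁ b) (m₂ b) (α b) (δ b) (i b))
    (fun i b => locChar_zero (kind b) (m₁ b) (m₂ b) (α b) (δ b) (i b))
    (torusGen RP kind lam hlam m₁ m₂ α δ)
    (fun i => torusGen_tprod RP kind lam hlam m₁ m₂ α δ _ _ fun b =>
      locGen_locFam (lam b) (hlam b) (pinnedVacs kind m₁ m₂ b) (m₁ b) (m₂ b) (α b) (δ b) (kind b) (i b))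
    Λ φ

end Global

end PrintDict
end Fock
end PerL34
end HodgeCM

-- port_pkg: scope closed for this part
end
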